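import Literature.Claims.NS.Piromthan2025
import HarnessLib

/-!
# C164 `Piromthan2025` — refutation kit (refuter of record ns-claims-refuter-3 g5)

Source: S. Piromthan, *Finite-time blowup for the 3D Navier–Stokes equations via vortex stretching*
(Zenodo 15737494, 2025), 8 pp.; typed skeleton `Literature.Claims.NS.Piromthan2025` (p537799), whose
composition `claim_of_steps (P : Posits) : Step4_CZ → Step5_maxPrinciple → … → Step52 → ClaimedTheorem`
consumes display (4) p.3 l.1–5 as its FIRST binder `h4 : Step4_CZ`.

* `not_Step4_CZ : ¬ Step4_CZ` — display (4) «‖∇u‖_{L∞} ≤ C‖ω‖_{L∞} for some universal constant C > 0»,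
  typed at field level over the `H^∞` divergence-free class `Chae2007.IsDatum`, is false: the tree's
  witness family `SupNormCZ.vel N` (`Literature.Barriers.NavierStokesRegularity.SupNormCalderonZygmundWitnesses`,
  Gilbarg–Trudinger Problem 4.9 (a) lacunary sums; `U = curl (u_N e₂)`) is `C_c^∞`, divergence free, has
  `sup ‖curl U‖ ≤ M` for one fixed `M > 0` and `‖∇U(0)‖ ≥ K` for every `K`. The double Riesz transform
  is unbounded on `L^∞`; only the Beale–Kato–Majda logarithmic form (the paper's own [1]) holds.
* `not_Step4_CZ_const` — the same for EVERY constant `C` (not only the `∃ C > 0` of the display).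
* `not_Step4_CZ_printedClass` — the same over the paper's OWN data class `Piromthan2025.IsDatum`
  (`C_c^∞`, divergence free): the witness is a genuine member of the printed class (p.1 l.26, p.7 l.56–60),
  not a degenerate / non-decaying / irrotational field.

WHAT THIS IS NOT: not a claim about NS regularity or blow-up; not a claim about any author beyond the
typed locator.
-/

set_option linter.dupNamespace false

noncomputable section

open Set
open scoped ContDiff

namespace Summit.NavierStokesRegularity.NavierStokesRegularity.Theorems.Piromthan2025

open Literature.Analysis Literature.Analysis.FluidPDE
open Literature.Claims.NS
open Literature.Claims.NS.Piromthan2025 (E3 Step4_CZ)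
open Literature.Barriers.NavierStokesRegularity.SupNormCZ (exists_velocity_gradient_witness
  hasRapidSpatialDecay_of_hasCompactSupport)

/-- A smooth, compactly supported, divergence-free field on `ℝ³` lies in the `H^∞` class
`Chae2007.IsDatum` (every derivative is in `L²`: compact support ⇒ rapid decay ⇒ `∫ ‖Dⁿv‖² < ∞`).
[folklore] -/
theorem isDatum_chae_of_compactSupport {v : E3 → E3} (hs : ContDiff ℝ ∞ v)
    (hc : HasCompactSupport v) (hd : VectorCalculus.IsDivFree v) : Chae2007.IsDatum v :=
  ⟨hs, hd, (hasRapidSpatialDecay_of_hasCompactSupport hs hc).lintegral_enorm_iteratedFDeriv_sq_lt_top⟩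

/-- A smooth, compactly supported, divergence-free field on `ℝ³` is a datum of the PRINTED class
(p.1 l.26 «u₀ ∈ C∞_c(ℝ³)», divergence free). [cite: Piromthan2025, p.1 l.26; p.7 l.56–60] -/
theorem isDatum_printed_of_compactSupport {v : E3 → E3} (hs : ContDiff ℝ ∞ v)
    (hc : HasCompactSupport v) (hd : VectorCalculus.IsDivFree v) : Piromthan2025.IsDatum v :=
  ⟨hs, hd, hc⟩

/-- **Display (4) p.3 l.1–5 is false for EVERY constant `C`** over the `H^∞` divergence-free class:
for each `C` some `C_c^∞` divergence-free `U` has `‖curl U‖ ≤ M` everywhere but `‖∇U(0)‖ > C·M`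
(tree witness `SupNormCZ.exists_velocity_gradient_witness`). [cite: Piromthan2025, (4) p.3 l.1–5] -/
theorem not_Step4_CZ_const (C : ℝ) :
    ¬ ∀ v : E3 → E3, Chae2007.IsDatum v →
        ∀ M : ℝ, (∀ y, ‖curl v y‖ ≤ M) → ∀ x, ‖fderiv ℝ v x‖ ≤ C * M := by
  intro h
  obtain ⟨M, _, hW⟩ := exists_velocity_gradient_witness
  obtain ⟨U, hs, hc, hd, hcurl, hK⟩ := hW (C * M + 1)
  have h0 := h U (isDatum_chae_of_compactSupport hs hc hd) M hcurl 0
  linarith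

/-- **C164 head — binder 1 of `claim_of_steps`: `¬ Step4_CZ`** (display (4) p.3 l.1–5 «∥∇u∥L∞ ≤
C∥ω∥L∞, for some universal constant C > 0 … derived from the Calderón–Zygmund kernel bound»).
Class: false lemma (countermodel) — the `C_c^∞` divergence-free lacunary witness `SupNormCZ.vel N`.
[cite: Piromthan2025, (4) p.3 l.1–5] -/
theorem not_Step4_CZ : ¬ Step4_CZ := fun ⟨C, _, h⟩ => not_Step4_CZ_const C h

/-- **The same display is false over the paper's OWN data class** `Piromthan2025.IsDatum`
(`C_c^∞`, divergence free; p.1 l.26, p.7 l.56–60), for every constant `C`: the witness is a genuine,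
compactly supported, rotational member of the printed class — no degenerate instance is used.
[cite: Piromthan2025, (4) p.3 l.1–5; p.1 l.26] -/
theorem not_Step4_CZ_printedClass (C : ℝ) :
    ¬ ∀ v : E3 → E3, Piromthan2025.IsDatum v →
        ∀ M : ℝ, (∀ y, ‖curl v y‖ ≤ M) → ∀ x, ‖fderiv ℝ v x‖ ≤ C * M := by
  intro h
  obtain ⟨M, _, hW⟩ := exists_velocity_gradient_witness
  obtain ⟨U, hs, hc, hd, hcurl, hK⟩ := hW (C * M + 1)
  have h0 := h U (isDatum_printed_of_compactSupport hs hc hd) M hcurl 0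
  linarith

/-- Records: the witness's vorticity bound `M` is POSITIVE and uniform in the family while the velocity
gradient at the origin is unbounded — the precise shape that display (4) forbids; equivalently the ratio
`‖∇U(0)‖ / sup‖curl U‖` is unbounded over `C_c^∞` divergence-free fields. [folklore] -/
theorem velocityGradient_unbounded_at_fixed_vorticityBound :
    ∃ M : ℝ, 0 < M ∧ ∀ K : ℝ, ∃ U : E3 → E3, Piromthan2025.IsDatum U ∧ Chae2007.IsDatum U ∧
      (∀ x, ‖curl U x‖ ≤ M) ∧ K ≤ ‖fderiv ℝ U 0‖ := by
  obtain ⟨M, hM, hW⟩ := exists_velocity_gradient_witness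
  refine ⟨M, hM, fun K => ?_⟩
  obtain ⟨U, hs, hc, hd, hcurl, hK⟩ := hW K
  exact ⟨U, isDatum_printed_of_compactSupport hs hc hd, isDatum_chae_of_compactSupport hs hc hd,
    hcurl, hK⟩

end Summit.NavierStokesRegularity.NavierStokesRegularity.Theorems.Piromthan2025

end
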